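import Summits.QuantumFields.BalabanUV.Beta.GAN24.WSlotForcingZeroMode
import Summits.QuantumFields.BalabanUV.Beta.GAN24.T2UnitSplitShapes
import Summits.QuantumFields.BalabanUV.Beta.GAN24.WilsonQuarticCharge

/-!
# `BalabanUV.Beta.GAN24.ChargeStepSym` — binder row G-an2-4 / (CONV-C), W-slot road «W3» (SKELETON-W3 v1.0.2 §8.3 ∕ §8.5 (N-F4d), typer
# `LEAVES.md` v3.12 § IV-C ROW W3-F4d), idle-seat kernel lemma after ROW W3-F2b (leaf-18 gen 17; journal NOTE l.9613): **THE EXACT ONE-STEP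
# RECURSION OF THE FIELD–FIELD ZERO-MODE CHARGE ALONG an2's NORMALISED STAGE-B FAMILY — the linear part acts by `λ₀ · Sym_{bond}`, NOT by a
# scalar — and the PIN-FREE necessary condition it imposes on ROW W3-F4d's `hZ0` given ROW W3-F2a at `m = 0`**

NOT IN PRINT; OUR OBSERVATION + [folklore] algebra over tree theorems (G-an2-4 formalisation swarm, leaf prover `b2b-balaban-gan24-formalise-leaf-18`,
gen 17; module name PROVISIONAL — the row owner gan24-p1 may rename ∕ re-home it).  HONEST FRAMING (cell contract, verbatim): «discharging `BetaPertH`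
makes Bałaban's UV stability UNCONDITIONAL — a real constructive-QFT result; it is NOT the continuum limit and NOT the Clay problem.»  HONEST DEPENDENCY
(verbatim): «continuum YM on T⁴ ⇐ BetaPertH ∧ nine spine estimates (0/9 proved); BetaPertH ⇐ (D1) ∧ (D4) ∧ CAP+tail; G-an2-4 gates asym, D1 and NE2/3/4.»

CONTEXT.  ROW W3-F4d of the owner's table asks, for the first difference `D 0 = T♮₁ − T♮₀` of the normalised family
`T♮_j := unitS₂ (sfStep Lc j) (smStep d Lc j) (T2Of d Lc cE cVH cΛ cE₂ cB Tc (vh₂S d Lc) mixFF j)`, the zero-mode hypothesis `hZ0 : Zfree (D 0)`;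
RULINGS-14d ∕ §8.5 (N-F4d) read it as «`Z_ff(T♮₁ − T♮₀) = (λ − 1)·Z_ff(T♮₀)`, hence `hZ0 ⟺ λ = 1` (the exact pin)», treating the linear part
`𝒜_j = lin4 (cE₂·Lc^{2(d+1)}) K♮_j Lc` as a SCALAR `λ` on the charge.  By `GAN24/Lin4ZeroMode.zmode_lin4_step` (ROW W3-F2b part 1) it is not: leaf-04's
`vsym = ½(V + V_swap)` makes `𝒜_j` act on the charge tensor `Z(μ,ν;α,β)` (bond directions `μ, ν`, fibre directions `α, β`) by `λ₀ · Sym_{μν}`.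
THIS FILE draws the consequences as tree theorems:
* §1 `succ_eq_lin4_add` (the affine step `T♮_{j+1} = 𝒜_j T♮_j + b_j`, leaf-04∕leaf-01, every per-level datum discharged by leaf-01's
  `T2UnitSplitShapes.step_data_of_shapes` — MODULO the mixed-table shape `hmix` only), `shape_bracket` (`b_j` is `LocStencil₂`, member-wise);
* §2 **`zmode_succ_eq`** — THE EXACT CHARGE RECURSION at any period `N`:
  `zmode N T♮_{j+1} (μ,ν;α,β) = zmode N (b j) (μ,ν;α,β) + N^{d+1}·(cE₂·Lc^{2(d+1)})·½·Lc^{−4(d+2)}·(zmode Lc T♮_j (μ,ν;α,β) + zmode Lc T♮_j (ν,μ;α,β))`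
  (at `N = Lc` the prefactor is `λ₀ = cE₂·Lc^{−(d+5)}`, sign `+`), and **`zmode_succ_antisymm`**: the bond-ANTISYMMETRIC part of the new charge is
  that of the SOURCE alone — `cE₂` and the pin drop out;
* §3 `member_zero_inl_inl`, **`zmode_member_zero`**: `zmode N T♮₀ (μ,ν;α,β) = cE₂ · N^{d+1} · Z₄(Tc)(μ,ν;α,β)`, `Z₄` the four-constant-leg charge of
  an3's bi-stencil `wilsonW₂ d Tc` at one first bond (leaf-18-g16's `WilsonQuarticCharge.tsum_wilsonW₂_ff_eq`; the border's ff block is `0`);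
* §4 **`quartic_charge_bond_symm_of_hZ0_of_hZb0`** (cell forms, any `N`) and **`quartic_charge_bond_symm_of_pointwise`** (pointwise forms of
  record): `hZ0` ∧ (ROW W3-F2a at `m = 0`) ⟹ `cE₂ · N^{d+1} · (Z₄(Tc)(μ,ν;α,β) − Z₄(Tc)(ν,μ;α,β)) = 0` — WHATEVER THE PIN, the initial quartic charge
  must be BOND-SYMMETRIC (or `cE₂ = 0`, or `N = 0`).
READING (docstring level; the table-specific half is NOT asserted here): leaf-18-g16's exact table for an3's colour-traced `PlaquetteVertex2Trace.w22 N`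
(`HOME/…/leaf-18/gen16/dw3/w22charge.out`; diagonal pattern kernel-checked as `tsum_wilsonW₂_w22_ff_diag_offdiag = −2N²`) is
`Z₄ = 2N²(δ_{κβ}δ_{κ′α} − δ_{κκ′}δ_{αβ})`, NOT bond-symmetric (`Z₄(0,1;1,0) = 2N² ≠ 0 = Z₄(1,0;1,0)`): at `Tc := w22 N` the rows W3-F2a (m = 0) and
W3-F4d (`hZ0`) cannot both hold unless `cE₂ = 0`, for every value of the pin; the kernel form of that instance needs the off-diagonal pattern values
of `Z₄(w22 N)` (a sequel); for a bond-symmetric `Tc` §2 gives `Z(D₀) = (λ₀ − 1)·Z₀ + Z(b₀)` and RULINGS-14d stands.  REPAIR MENU for the owner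
(journal l.9613): (R1) unroll END #2 from `D₁` (`Sym ∘ Asym = 0`: the antisymmetric defect dies after ONE more transport), (R2) bond-symmetric member `0`.
Asserts NO shape or rate of Bałaban's tables beyond an2's member-wise `T2Of_loc`; discharges NOTHING of «T2Shape» ∕ «T2SupRate» ∕ «T2Drift» ∕
(hW, hWall); `hpin` not used; 0 `def`, 0 cite, 0 `def … : Prop`, 0 sorry, 0 wall binders instantiated; NOT «W-slot closed», NEVER «G-an2-4 closed»;
NOT BetaPertH, NOT continuum, NOT Clay.
-/

noncomputable section

open Finset
open scoped BigOperators
open Literature.MathematicalPhysics.QuantumFieldTheory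
open Literature.MathematicalPhysics.QuantumFieldTheory.Balaban1983to89
open Literature.MathematicalPhysics.QuantumFieldTheory.Balaban1983to89.Beta
open ExpKernelCalculus (MKer Decays shiftK)
open OneStepResolventKernel (Fib)
open OneStepKernelFamily (KInvStep decays_KInvStep)
open StepJetData (mfNeg mfNeg_inl_inl)
open BalabanCompositeJets (LocStencil₂)
open SecondOrderResponse (LocStencilFM W2SymOfK)
open BalabanStepJetsSucc (mmRead)
open BalabanStepW2 (K3OfK Spure M1 M2Of T2Of T2Of_zero)
open AveragingMixedJetTables (vh₂S)
open AffineAveraging (box toSite)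
open WilsonBiStencil (wilsonW₂)
open Summit.QuantumFields.BalabanUV.Beta.HessKerDressedUnits (unitK unitS decays_unitK legScale_inl)
open Summit.QuantumFields.BalabanUV.Beta.SecondOrderUnits (unitM unitS₂ unitM₂)
open Summit.QuantumFields.BalabanUV.Beta.GAN24.CombesThomas (sfStep smStep)
open Summit.QuantumFields.BalabanUV.Beta.GAN24.T2SlotUnits (unitS₂_apply locStencil₂_vh₂S vh₂S_inl_inl vh₂S_inr_inr)
open Summit.QuantumFields.BalabanUV.Beta.GAN24.T2RecursionAffine (lin4)
open Summit.QuantumFields.BalabanUV.Beta.GAN24.BiStencilZeroMode (Tab zmode)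
open Summit.QuantumFields.BalabanUV.Beta.GAN24.TransversalZeroMode (card_box_succ zmode_eq_zero_of_inner_eq_zero)
open Summit.QuantumFields.BalabanUV.Beta.GAN24.T2SlotCovariance (unitS₂_T2Of_translate)
open Summit.QuantumFields.BalabanUV.Beta.GAN24.WSlotFirstDiff (zmode_add zmode_sub zmode_smul)
open Summit.QuantumFields.BalabanUV.Beta.GAN24.Lin4ZeroMode (locStencil₂_lin4 zmode_lin4_step)
open Summit.QuantumFields.BalabanUV.Beta.GAN24.WSlotForcingZeroMode (locStencil₂_sub shape_member)
open Summit.QuantumFields.BalabanUV.Beta.GAN24.T2UnitSplitLevels (unitS₂_T2Of_succ_eq_lin4_add)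
open Summit.QuantumFields.BalabanUV.Beta.GAN24.T2UnitSplitShapes (step_data_of_shapes)
open Summit.QuantumFields.BalabanUV.Beta.GAN24.WilsonQuarticCharge (tsum_wilsonW₂_ff_eq)

namespace Summit.QuantumFields.BalabanUV.Beta.GAN24.ChargeStepSym

variable {d Lc : ℕ} [NeZero Lc]

/-! ## §1 The affine step of the normalised family with every datum discharged (modulo the mixed-table shape) -/

/-- [folklore] **THE AFFINE STEP `T♮_{j+1} = 𝒜_j T♮_j + b_j` FOR an1's BORDER TABLE, MODULO `hmix` ONLY** (leaf-01's
`T2UnitSplitLevels.unitS₂_T2Of_succ_eq_lin4_add` with leaf-04's per-level step data discharged by leaf-01's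
`T2UnitSplitShapes.step_data_of_shapes`; border off-diagonality by leaf-19's `vh₂S_inl_inl`∕`vh₂S_inr_inr`). -/
theorem succ_eq_lin4_add (hLc : 1 ≤ Lc) (cE cVH cΛ cE₂ cB : ℝ) (Tc : Fin 4 → Fin 4 → Fin 4 → Fin 4 → ℝ)
    {mixFF : Tab d} (hmix : ∃ C δ : ℝ, 0 < δ ∧ LocStencilFM Lc mixFF C δ) (j : ℕ) :
    unitS₂ (sfStep Lc (j + 1)) (smStep d Lc (j + 1)) (T2Of d Lc cE cVH cΛ cE₂ cB Tc (vh₂S d Lc) mixFF (j + 1)) =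
      lin4 (cE₂ * (Lc : ℝ) ^ (2 * (d + 1))) (unitK (sfStep Lc j) (smStep d Lc j) (KInvStep (d := d) Lc j)) Lc
          (unitS₂ (sfStep Lc j) (smStep d Lc j) (T2Of d Lc cE cVH cΛ cE₂ cB Tc (vh₂S d Lc) mixFF j))
        + (fun κ u κ' u' => (cE₂ * (Lc : ℝ) ^ (2 * (d + 1))) • mmRead Lc (K3OfK
            (unitK (sfStep Lc j) (smStep d Lc j) (KInvStep (d := d) Lc j)) Lc (unitS (sfStep Lc j) (smStep d Lc j) (Spure d Lc cE cVH cΛ j))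
            (unitM (sfStep Lc j) (smStep d Lc j) (M1 d Lc cΛ j)) (W2SymOfK (unitK (sfStep Lc j) (smStep d Lc j) (KInvStep (d := d) Lc j)) Lc
            (unitS (sfStep Lc j) (smStep d Lc j) (Spure d Lc cE cVH cΛ j)) (unitM (sfStep Lc j) (smStep d Lc j) (M1 d Lc cΛ j)) 0
            (unitM₂ (sfStep Lc j) (smStep d Lc j) (M2Of d Lc mixFF j))) κ u κ' u') + cB • mfNeg ((vh₂S d Lc) κ u κ' u')) := by
  have hB : ∃ C δ : ℝ, 0 < δ ∧ LocStencil₂ (vh₂S d Lc) C δ := ⟨_, 1, one_pos, locStencil₂_vh₂S hLc zero_le_one⟩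
  obtain ⟨C, δ, C₀, C₁, hδ, hK, h₀, hW⟩ := step_data_of_shapes hLc cE cVH cΛ cE₂ cB Tc hB hmix j
  exact unitS₂_T2Of_succ_eq_lin4_add cE cVH cΛ cE₂ cB Tc (vh₂S d Lc) mixFF (vh₂S_inl_inl Lc) (vh₂S_inr_inr Lc) j hδ hK h₀ hW

/-- [folklore] **THE BRACKET `b_j` IS A `LocStencil₂` TABLE** (member-wise, SOME rate): `b_j = T♮_{j+1} − 𝒜_j T♮_j` (§1), both terms
`LocStencil₂` (leaf-07's member shape ∕ leaf-10's `locStencil₂_lin_step`). -/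
theorem shape_bracket (hLc : 1 ≤ Lc) (cE cVH cΛ cE₂ cB : ℝ) (Tc : Fin 4 → Fin 4 → Fin 4 → Fin 4 → ℝ)
    {mixFF : Tab d} (hmix : ∃ C δ : ℝ, 0 < δ ∧ LocStencilFM Lc mixFF C δ) (j : ℕ) :
    ∃ C δ : ℝ, 0 < δ ∧ LocStencil₂ (fun κ u κ' u' => (cE₂ * (Lc : ℝ) ^ (2 * (d + 1))) • mmRead Lc (K3OfK
            (unitK (sfStep Lc j) (smStep d Lc j) (KInvStep (d := d) Lc j)) Lc (unitS (sfStep Lc j) (smStep d Lc j) (Spure d Lc cE cVH cΛ j))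
            (unitM (sfStep Lc j) (smStep d Lc j) (M1 d Lc cΛ j)) (W2SymOfK (unitK (sfStep Lc j) (smStep d Lc j) (KInvStep (d := d) Lc j)) Lc
            (unitS (sfStep Lc j) (smStep d Lc j) (Spure d Lc cE cVH cΛ j)) (unitM (sfStep Lc j) (smStep d Lc j) (M1 d Lc cΛ j)) 0
            (unitM₂ (sfStep Lc j) (smStep d Lc j) (M2Of d Lc mixFF j))) κ u κ' u') + cB • mfNeg ((vh₂S d Lc) κ u κ' u')) C δ := by
  obtain ⟨CT, δT, hδT, hT⟩ := shape_member hLc cE cVH cΛ cE₂ cB Tc hmix j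
  obtain ⟨CT', δT', hδT', hT'⟩ := shape_member hLc cE cVH cΛ cE₂ cB Tc hmix (j + 1)
  obtain ⟨m, C, hm, hC, hK⟩ := decays_KInvStep (Lc := Lc) (d := d) j
  have hA := locStencil₂_lin4 (decays_unitK (sf := sfStep Lc j) (sm := smStep d Lc j) hK) (by positivity) hm hLc
    (cE₂ * (Lc : ℝ) ^ (2 * (d + 1))) hT hδT
  have hr : 0 < min δT' (min m δT / 128) := by positivity
  have hsub := locStencil₂_sub (hT'.mono (min_le_left _ _)) (hA.mono (min_le_right _ _))
  have e := succ_eq_lin4_add hLc cE cVH cΛ cE₂ cB Tc hmix j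
  rw [e, add_sub_cancel_left] at hsub
  exact ⟨_, _, hr, hsub⟩

/-! ## §2 THE EXACT ONE-STEP CHARGE RECURSION: the linear part acts on the charge tensor by `λ₀ · Sym_{bond}` -/

/-- **THE ONE-STEP CHARGE RECURSION OF THE NORMALISED STAGE-B FAMILY** [folklore composition], cell form at any period `N`:
`zmode N T♮_{j+1} (μ,ν;α,β) = zmode N (b j) (μ,ν;α,β) + N^{d+1}·(cE₂·Lc^{2(d+1)})·½·Lc^{−4(d+2)}·(zmode Lc T♮_j (μ,ν;α,β) + zmode Lc T♮_j (ν,μ;α,β))`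
— the linear part `𝒜_j = lin4 (cE₂·Lc^{2(d+1)}) K♮_j Lc` acts on the field–field charge tensor NOT by a scalar but by
`λ₀ · Sym_{bond}` (`Lin4ZeroMode.zmode_lin4_step`: leaf-04's `vsym = ½(V + V_swap)` reads the input charge once at `(μ,ν)` and once at
`(ν,μ)`); at `N = Lc`, `λ₀ = Lc^{d+1}·cE₂·Lc^{2(d+1)}·Lc^{−4(d+2)} = cE₂·Lc^{−(d+5)}`.  Hypotheses: `1 ≤ Lc`, the mixed-table binders `hmix`
(shape, ∃-form) and `hmixt` (covariance); all colour constants symbolic, every `j`, generic `d`. -/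
theorem zmode_succ_eq (hLc : 1 ≤ Lc) (N : ℕ) (cE cVH cΛ cE₂ cB : ℝ) (Tc : Fin 4 → Fin 4 → Fin 4 → Fin 4 → ℝ)
    {mixFF : Tab d} (hmix : ∃ C δ : ℝ, 0 < δ ∧ LocStencilFM Lc mixFF C δ)
    (hmixt : ∀ (κ : Fin (d + 1)) (u : Fin (d + 1) → ℤ) (ρ : Fin (d + 1)) (w t : Fin (d + 1) → ℤ),
      mixFF κ (u + (Lc : ℤ) • t) ρ (w + t) = shiftK (-((Lc : ℤ) • t)) (mixFF κ u ρ w))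
    (j : ℕ) (μ ν α β : Fin (d + 1)) :
    zmode N (unitS₂ (sfStep Lc (j + 1)) (smStep d Lc (j + 1)) (T2Of d Lc cE cVH cΛ cE₂ cB Tc (vh₂S d Lc) mixFF (j + 1))) μ ν
        (Sum.inl α) (Sum.inl β)
      = zmode N (fun κ u κ' u' => (cE₂ * (Lc : ℝ) ^ (2 * (d + 1))) • mmRead Lc (K3OfK
            (unitK (sfStep Lc j) (smStep d Lc j) (KInvStep (d := d) Lc j)) Lc (unitS (sfStep Lc j) (smStep d Lc j) (Spure d Lc cE cVH cΛ j))
            (unitM (sfStep Lc j) (smStep d Lc j) (M1 d Lc cΛ j)) (W2SymOfK (unitK (sfStep Lc j) (smStep d Lc j) (KInvStep (d := d) Lc j)) Lc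
            (unitS (sfStep Lc j) (smStep d Lc j) (Spure d Lc cE cVH cΛ j)) (unitM (sfStep Lc j) (smStep d Lc j) (M1 d Lc cΛ j)) 0
            (unitM₂ (sfStep Lc j) (smStep d Lc j) (M2Of d Lc mixFF j))) κ u κ' u') + cB • mfNeg ((vh₂S d Lc) κ u κ' u'))
          μ ν (Sum.inl α) (Sum.inl β)
        + ((N : ℝ) ^ (d + 1)) * ((cE₂ * (Lc : ℝ) ^ (2 * (d + 1))) * ((1 / 2 : ℝ) * (((Lc : ℝ) ^ (d + 1 + 1))⁻¹) ^ 4) *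
          (zmode Lc (unitS₂ (sfStep Lc j) (smStep d Lc j) (T2Of d Lc cE cVH cΛ cE₂ cB Tc (vh₂S d Lc) mixFF j)) μ ν (Sum.inl α) (Sum.inl β)
            + zmode Lc (unitS₂ (sfStep Lc j) (smStep d Lc j) (T2Of d Lc cE cVH cΛ cE₂ cB Tc (vh₂S d Lc) mixFF j)) ν μ (Sum.inl α) (Sum.inl β))) := by
  obtain ⟨CT, δT, hδT, hT⟩ := shape_member hLc cE cVH cΛ cE₂ cB Tc hmix j
  have hTcov := fun κ u κ' u' t => unitS₂_T2Of_translate hLc cE cVH cΛ cE₂ cB Tc hmixt j κ u κ' u' t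
  obtain ⟨m, C, hm, hC, hK⟩ := decays_KInvStep (Lc := Lc) (d := d) j
  have hA := locStencil₂_lin4 (decays_unitK (sf := sfStep Lc j) (sm := smStep d Lc j) hK) (by positivity) hm hLc
    (cE₂ * (Lc : ℝ) ^ (2 * (d + 1))) hT hδT
  obtain ⟨Cb, δb, hδb, hb⟩ := shape_bracket hLc cE cVH cΛ cE₂ cB Tc hmix j
  have hr : 0 < min (min m δT / 128) δb := by positivity
  rw [succ_eq_lin4_add hLc cE cVH cΛ cE₂ cB Tc hmix j]
  have e := zmode_add (N := N) (hA.mono (min_le_left _ _)) (hb.mono (min_le_right _ _)) hr μ ν (Sum.inl α) (Sum.inl β)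
  have e' : zmode N (lin4 (cE₂ * (Lc : ℝ) ^ (2 * (d + 1))) (unitK (sfStep Lc j) (smStep d Lc j) (KInvStep (d := d) Lc j)) Lc
          (unitS₂ (sfStep Lc j) (smStep d Lc j) (T2Of d Lc cE cVH cΛ cE₂ cB Tc (vh₂S d Lc) mixFF j))
        + (fun κ u κ' u' => (cE₂ * (Lc : ℝ) ^ (2 * (d + 1))) • mmRead Lc (K3OfK
            (unitK (sfStep Lc j) (smStep d Lc j) (KInvStep (d := d) Lc j)) Lc (unitS (sfStep Lc j) (smStep d Lc j) (Spure d Lc cE cVH cΛ j))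
            (unitM (sfStep Lc j) (smStep d Lc j) (M1 d Lc cΛ j)) (W2SymOfK (unitK (sfStep Lc j) (smStep d Lc j) (KInvStep (d := d) Lc j)) Lc
            (unitS (sfStep Lc j) (smStep d Lc j) (Spure d Lc cE cVH cΛ j)) (unitM (sfStep Lc j) (smStep d Lc j) (M1 d Lc cΛ j)) 0
            (unitM₂ (sfStep Lc j) (smStep d Lc j) (M2Of d Lc mixFF j))) κ u κ' u') + cB • mfNeg ((vh₂S d Lc) κ u κ' u')))
          μ ν (Sum.inl α) (Sum.inl β) = _ := e
  rw [e', zmode_lin4_step hLc N j _ hT hδT hTcov, add_comm]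

/-- **THE BOND-ANTISYMMETRIC PART OF THE CHARGE IS PIN-FREE** [folklore]: since `Sym` is symmetric, the transported term cancels in
`zmode N T♮_{j+1} (μ,ν) − zmode N T♮_{j+1} (ν,μ) = zmode N (b j) (μ,ν) − zmode N (b j) (ν,μ)` — the antisymmetric part of the new member's
charge is that of the SOURCE alone, whatever `cE₂`. -/
theorem zmode_succ_antisymm (hLc : 1 ≤ Lc) (N : ℕ) (cE cVH cΛ cE₂ cB : ℝ) (Tc : Fin 4 → Fin 4 → Fin 4 → Fin 4 → ℝ)
    {mixFF : Tab d} (hmix : ∃ C δ : ℝ, 0 < δ ∧ LocStencilFM Lc mixFF C δ)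
    (hmixt : ∀ (κ : Fin (d + 1)) (u : Fin (d + 1) → ℤ) (ρ : Fin (d + 1)) (w t : Fin (d + 1) → ℤ),
      mixFF κ (u + (Lc : ℤ) • t) ρ (w + t) = shiftK (-((Lc : ℤ) • t)) (mixFF κ u ρ w))
    (j : ℕ) (μ ν α β : Fin (d + 1)) :
    zmode N (unitS₂ (sfStep Lc (j + 1)) (smStep d Lc (j + 1)) (T2Of d Lc cE cVH cΛ cE₂ cB Tc (vh₂S d Lc) mixFF (j + 1))) μ ν
        (Sum.inl α) (Sum.inl β)
      - zmode N (unitS₂ (sfStep Lc (j + 1)) (smStep d Lc (j + 1)) (T2Of d Lc cE cVH cΛ cE₂ cB Tc (vh₂S d Lc) mixFF (j + 1))) ν μ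
        (Sum.inl α) (Sum.inl β)
      = zmode N (fun κ u κ' u' => (cE₂ * (Lc : ℝ) ^ (2 * (d + 1))) • mmRead Lc (K3OfK
            (unitK (sfStep Lc j) (smStep d Lc j) (KInvStep (d := d) Lc j)) Lc (unitS (sfStep Lc j) (smStep d Lc j) (Spure d Lc cE cVH cΛ j))
            (unitM (sfStep Lc j) (smStep d Lc j) (M1 d Lc cΛ j)) (W2SymOfK (unitK (sfStep Lc j) (smStep d Lc j) (KInvStep (d := d) Lc j)) Lc
            (unitS (sfStep Lc j) (smStep d Lc j) (Spure d Lc cE cVH cΛ j)) (unitM (sfStep Lc j) (smStep d Lc j) (M1 d Lc cΛ j)) 0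
            (unitM₂ (sfStep Lc j) (smStep d Lc j) (M2Of d Lc mixFF j))) κ u κ' u') + cB • mfNeg ((vh₂S d Lc) κ u κ' u'))
          μ ν (Sum.inl α) (Sum.inl β)
        - zmode N (fun κ u κ' u' => (cE₂ * (Lc : ℝ) ^ (2 * (d + 1))) • mmRead Lc (K3OfK
            (unitK (sfStep Lc j) (smStep d Lc j) (KInvStep (d := d) Lc j)) Lc (unitS (sfStep Lc j) (smStep d Lc j) (Spure d Lc cE cVH cΛ j))
            (unitM (sfStep Lc j) (smStep d Lc j) (M1 d Lc cΛ j)) (W2SymOfK (unitK (sfStep Lc j) (smStep d Lc j) (KInvStep (d := d) Lc j)) Lc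
            (unitS (sfStep Lc j) (smStep d Lc j) (Spure d Lc cE cVH cΛ j)) (unitM (sfStep Lc j) (smStep d Lc j) (M1 d Lc cΛ j)) 0
            (unitM₂ (sfStep Lc j) (smStep d Lc j) (M2Of d Lc mixFF j))) κ u κ' u') + cB • mfNeg ((vh₂S d Lc) κ u κ' u'))
          ν μ (Sum.inl α) (Sum.inl β) := by
  rw [zmode_succ_eq hLc N cE cVH cΛ cE₂ cB Tc hmix hmixt j μ ν α β, zmode_succ_eq hLc N cE cVH cΛ cE₂ cB Tc hmix hmixt j ν μ α β]
  ring

/-! ## §3 The charge of member `0` is `cE₂ ×` the quartic Wilson charge; its bond transpose -/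

/-- [folklore] The field–field entries of the normalised member `0` are `cE₂ ·` those of an3's Wilson bi-stencil (`T2Of_zero`; units
`Lc^0 = 1`; the border's field–field block vanishes, `vh₂S_inl_inl`). -/
theorem member_zero_inl_inl (cE cVH cΛ cE₂ cB : ℝ) (Tc : Fin 4 → Fin 4 → Fin 4 → Fin 4 → ℝ) (mixFF : Tab d)
    (κ : Fin (d + 1)) (u : Fin (d + 1) → ℤ) (κ' : Fin (d + 1)) (u' x z : Fin (d + 1) → ℤ) (α β : Fin (d + 1)) :
    unitS₂ (sfStep Lc 0) (smStep d Lc 0) (T2Of d Lc cE cVH cΛ cE₂ cB Tc (vh₂S d Lc) mixFF 0) κ u κ' u' x z (Sum.inl α) (Sum.inl β)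
      = cE₂ * wilsonW₂ d Tc κ u κ' u' x z (Sum.inl α) (Sum.inl β) := by
  rw [unitS₂_apply, T2Of_zero]
  simp only [sfStep, smStep, pow_zero, zero_mul, inv_one, one_mul, mul_one, legScale_inl, Pi.add_apply, Pi.smul_apply, smul_eq_mul,
    mfNeg_inl_inl, vh₂S_inl_inl, mul_zero, add_zero]

/-- [folklore] **THE FIELD–FIELD CHARGE OF MEMBER `0`** at any period `N`: `zmode N T♮₀ (μ,ν;α,β) = cE₂ · N^{d+1} · Z₄(Tc)(μ,ν;α,β)` with
`Z₄(Tc)(μ,ν;α,β) := Σ'_{u′xz} wilsonW₂ d Tc μ 0 ν u′ x z (inl α) (inl β)` the four-constant-leg charge of an3's bi-stencil at one first bond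
(first-bond-free by leaf-18-g16's `WilsonQuarticCharge.tsum_wilsonW₂_ff_eq`). -/
theorem zmode_member_zero (N : ℕ) (cE cVH cΛ cE₂ cB : ℝ) (Tc : Fin 4 → Fin 4 → Fin 4 → Fin 4 → ℝ) (mixFF : Tab d)
    (μ ν α β : Fin (d + 1)) :
    zmode N (unitS₂ (sfStep Lc 0) (smStep d Lc 0) (T2Of d Lc cE cVH cΛ cE₂ cB Tc (vh₂S d Lc) mixFF 0)) μ ν (Sum.inl α) (Sum.inl β)
      = cE₂ * (((N : ℝ) ^ (d + 1)) *
          ∑' u' : Fin (d + 1) → ℤ, ∑' x : Fin (d + 1) → ℤ, ∑' z : Fin (d + 1) → ℤ,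
            wilsonW₂ d Tc μ 0 ν u' x z (Sum.inl α) (Sum.inl β)) := by
  unfold zmode
  simp_rw [member_zero_inl_inl, tsum_mul_left]
  rw [← Finset.mul_sum]
  congr 1
  rw [Finset.sum_congr rfl fun r _ => (by rw [tsum_wilsonW₂_ff_eq, tsum_wilsonW₂_ff_eq] :
      (∑' u' : Fin (d + 1) → ℤ, ∑' x : Fin (d + 1) → ℤ, ∑' z : Fin (d + 1) → ℤ,
          wilsonW₂ d Tc μ (toSite r) ν u' x z (Sum.inl α) (Sum.inl β))
        = ∑' u' : Fin (d + 1) → ℤ, ∑' x : Fin (d + 1) → ℤ, ∑' z : Fin (d + 1) → ℤ,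
          wilsonW₂ d Tc μ 0 ν u' x z (Sum.inl α) (Sum.inl β)),
    Finset.sum_const, card_box_succ, nsmul_eq_mul]
  push_cast
  ring

/-! ## §4 THE PIN-FREE NECESSARY CONDITION FOR ROW W3-F4d's `hZ0` GIVEN ROW W3-F2a AT `m = 0` -/

/-- **`hZ0` AND THE SOURCE ZERO MODE AT `m = 0` FORCE A BOND-SYMMETRIC INITIAL CHARGE — WHATEVER THE PIN** [our observation; folklore
algebra over tree theorems].  Cell forms at any period `N`: if the first difference `T♮₁ − T♮₀` is field–field zero-mode-free (ROW W3-F4d's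
`hZ0`, R14-6 form) and the bracket `b 0` is field–field zero-mode-free (ROW W3-F2a at `m = 0`), then
`cE₂ · N^{d+1} · (Z₄(Tc)(μ,ν;α,β) − Z₄(Tc)(ν,μ;α,β)) = 0` for all directions: for `cE₂ ≠ 0`, `N ≠ 0` the quartic Wilson charge of the table
`Tc` must be symmetric under the exchange of its two BOND directions at fixed fibre directions.  (§2: the transported term is
bond-symmetrised and drops out of the antisymmetric part; §3: member `0`'s charge.)  For a table whose charge is NOT bond-symmetric — e.g.
an3's colour-traced `w22 N`, whose charge `2N²(δ_{κβ}δ_{κ′α} − δ_{κκ′}δ_{αβ})` (leaf-18-g16's exact table; diagonal pattern kernel-checked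
in `WilsonQuarticCharge`) has `Z₄(0,1;1,0) = 2N² ≠ 0 = Z₄(1,0;1,0)` — the two rows cannot both hold unless `cE₂ = 0`, for EVERY value of
the pin; for a bond-symmetric `Tc` the design `hZ0 ⟺ λ₀ = 1` (RULINGS-14d) stands. -/
theorem quartic_charge_bond_symm_of_hZ0_of_hZb0 (hLc : 1 ≤ Lc) (N : ℕ) (cE cVH cΛ cE₂ cB : ℝ)
    (Tc : Fin 4 → Fin 4 → Fin 4 → Fin 4 → ℝ) {mixFF : Tab d} (hmix : ∃ C δ : ℝ, 0 < δ ∧ LocStencilFM Lc mixFF C δ)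
    (hmixt : ∀ (κ : Fin (d + 1)) (u : Fin (d + 1) → ℤ) (ρ : Fin (d + 1)) (w t : Fin (d + 1) → ℤ),
      mixFF κ (u + (Lc : ℤ) • t) ρ (w + t) = shiftK (-((Lc : ℤ) • t)) (mixFF κ u ρ w))
    (hZ0 : ∀ (κ κ' α β : Fin (d + 1)), zmode N (fun κ u κ' u' =>
        unitS₂ (sfStep Lc 1) (smStep d Lc 1) (T2Of d Lc cE cVH cΛ cE₂ cB Tc (vh₂S d Lc) mixFF 1) κ u κ' u'
          - unitS₂ (sfStep Lc 0) (smStep d Lc 0) (T2Of d Lc cE cVH cΛ cE₂ cB Tc (vh₂S d Lc) mixFF 0) κ u κ' u')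
        κ κ' (Sum.inl α) (Sum.inl β) = 0)
    (hZb0 : ∀ (κ κ' α β : Fin (d + 1)), zmode N (fun κ u κ' u' => (cE₂ * (Lc : ℝ) ^ (2 * (d + 1))) • mmRead Lc (K3OfK
            (unitK (sfStep Lc 0) (smStep d Lc 0) (KInvStep (d := d) Lc 0)) Lc (unitS (sfStep Lc 0) (smStep d Lc 0) (Spure d Lc cE cVH cΛ 0))
            (unitM (sfStep Lc 0) (smStep d Lc 0) (M1 d Lc cΛ 0)) (W2SymOfK (unitK (sfStep Lc 0) (smStep d Lc 0) (KInvStep (d := d) Lc 0)) Lc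
            (unitS (sfStep Lc 0) (smStep d Lc 0) (Spure d Lc cE cVH cΛ 0)) (unitM (sfStep Lc 0) (smStep d Lc 0) (M1 d Lc cΛ 0)) 0
            (unitM₂ (sfStep Lc 0) (smStep d Lc 0) (M2Of d Lc mixFF 0))) κ u κ' u') + cB • mfNeg ((vh₂S d Lc) κ u κ' u'))
        κ κ' (Sum.inl α) (Sum.inl β) = 0)
    (μ ν α β : Fin (d + 1)) :
    cE₂ * (((N : ℝ) ^ (d + 1)) *
        ((∑' u' : Fin (d + 1) → ℤ, ∑' x : Fin (d + 1) → ℤ, ∑' z : Fin (d + 1) → ℤ, wilsonW₂ d Tc μ 0 ν u' x z (Sum.inl α) (Sum.inl β))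
          - ∑' u' : Fin (d + 1) → ℤ, ∑' x : Fin (d + 1) → ℤ, ∑' z : Fin (d + 1) → ℤ, wilsonW₂ d Tc ν 0 μ u' x z (Sum.inl α) (Sum.inl β))) = 0 := by
  obtain ⟨C0, δ0, hδ0, h0⟩ := shape_member hLc cE cVH cΛ cE₂ cB Tc hmix 0
  obtain ⟨C1, δ1, hδ1, h1⟩ := shape_member hLc cE cVH cΛ cE₂ cB Tc hmix 1
  have hr : 0 < min δ0 δ1 := lt_min hδ0 hδ1
  -- charge conservation at step 1 (the `zff_sub_iff` reformulation of leaf-07's `WSlotFirstDiff`)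
  have hcons : ∀ κ κ' α β : Fin (d + 1),
      zmode N (unitS₂ (sfStep Lc 1) (smStep d Lc 1) (T2Of d Lc cE cVH cΛ cE₂ cB Tc (vh₂S d Lc) mixFF 1)) κ κ' (Sum.inl α) (Sum.inl β)
        = zmode N (unitS₂ (sfStep Lc 0) (smStep d Lc 0) (T2Of d Lc cE cVH cΛ cE₂ cB Tc (vh₂S d Lc) mixFF 0)) κ κ' (Sum.inl α) (Sum.inl β) :=
    fun κ κ' α β => sub_eq_zero.1 (by rw [← zmode_sub (N := N) (h1.mono (min_le_right _ _)) (h0.mono (min_le_left _ _)) hr]; exact hZ0 κ κ' α β)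
  have ha := zmode_succ_antisymm hLc N cE cVH cΛ cE₂ cB Tc hmix hmixt 0 μ ν α β
  rw [hcons, hcons, hZb0, hZb0, sub_zero, zmode_member_zero, zmode_member_zero] at ha
  linear_combination ha

/-- **THE SAME FROM THE POINTWISE FORMS OF RECORD** (ref2 R51-2 ∕ (w2)) [folklore]: pointwise zero modes imply the cell ones
(`TransversalZeroMode.zmode_eq_zero_of_inner_eq_zero`), so the conclusion of `quartic_charge_bond_symm_of_hZ0_of_hZb0` holds as well. -/
theorem quartic_charge_bond_symm_of_pointwise (hLc : 1 ≤ Lc) (N : ℕ) (cE cVH cΛ cE₂ cB : ℝ)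
    (Tc : Fin 4 → Fin 4 → Fin 4 → Fin 4 → ℝ) {mixFF : Tab d} (hmix : ∃ C δ : ℝ, 0 < δ ∧ LocStencilFM Lc mixFF C δ)
    (hmixt : ∀ (κ : Fin (d + 1)) (u : Fin (d + 1) → ℤ) (ρ : Fin (d + 1)) (w t : Fin (d + 1) → ℤ),
      mixFF κ (u + (Lc : ℤ) • t) ρ (w + t) = shiftK (-((Lc : ℤ) • t)) (mixFF κ u ρ w))
    (hZ0 : ∀ (κ : Fin (d + 1)) (u : Fin (d + 1) → ℤ) (κ' α β : Fin (d + 1)), (∑' u', ∑' x, ∑' z, (fun κ u κ' u' =>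
        unitS₂ (sfStep Lc 1) (smStep d Lc 1) (T2Of d Lc cE cVH cΛ cE₂ cB Tc (vh₂S d Lc) mixFF 1) κ u κ' u'
          - unitS₂ (sfStep Lc 0) (smStep d Lc 0) (T2Of d Lc cE cVH cΛ cE₂ cB Tc (vh₂S d Lc) mixFF 0) κ u κ' u')
        κ u κ' u' x z (Sum.inl α) (Sum.inl β)) = 0)
    (hZb0 : ∀ (κ : Fin (d + 1)) (u : Fin (d + 1) → ℤ) (κ' α β : Fin (d + 1)), (∑' u', ∑' x, ∑' z,
        ((cE₂ * (Lc : ℝ) ^ (2 * (d + 1))) • mmRead Lc (K3OfK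
            (unitK (sfStep Lc 0) (smStep d Lc 0) (KInvStep (d := d) Lc 0)) Lc (unitS (sfStep Lc 0) (smStep d Lc 0) (Spure d Lc cE cVH cΛ 0))
            (unitM (sfStep Lc 0) (smStep d Lc 0) (M1 d Lc cΛ 0)) (W2SymOfK (unitK (sfStep Lc 0) (smStep d Lc 0) (KInvStep (d := d) Lc 0)) Lc
            (unitS (sfStep Lc 0) (smStep d Lc 0) (Spure d Lc cE cVH cΛ 0)) (unitM (sfStep Lc 0) (smStep d Lc 0) (M1 d Lc cΛ 0)) 0
            (unitM₂ (sfStep Lc 0) (smStep d Lc 0) (M2Of d Lc mixFF 0))) κ u κ' u') + cB • mfNeg ((vh₂S d Lc) κ u κ' u'))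
          x z (Sum.inl α) (Sum.inl β)) = 0)
    (μ ν α β : Fin (d + 1)) :
    cE₂ * (((N : ℝ) ^ (d + 1)) *
        ((∑' u' : Fin (d + 1) → ℤ, ∑' x : Fin (d + 1) → ℤ, ∑' z : Fin (d + 1) → ℤ, wilsonW₂ d Tc μ 0 ν u' x z (Sum.inl α) (Sum.inl β))
          - ∑' u' : Fin (d + 1) → ℤ, ∑' x : Fin (d + 1) → ℤ, ∑' z : Fin (d + 1) → ℤ, wilsonW₂ d Tc ν 0 μ u' x z (Sum.inl α) (Sum.inl β))) = 0 :=
  quartic_charge_bond_symm_of_hZ0_of_hZb0 hLc N cE cVH cΛ cE₂ cB Tc hmix hmixt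
    (fun κ κ' α β => zmode_eq_zero_of_inner_eq_zero N fun u => hZ0 κ u κ' α β)
    (fun κ κ' α β => zmode_eq_zero_of_inner_eq_zero N fun u => hZb0 κ u κ' α β) μ ν α β

end Summit.QuantumFields.BalabanUV.Beta.GAN24.ChargeStepSym

end
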